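import Literature.Probability.LatticeModels.SourcedCurrentLaw
import Literature.Probability.LatticeModels.CurrentsPartialMonotonicity
import HarnessLib

/-!
# Crux `IndependentStrandsJoin` (stmt-CriticalPhenomena-14625), reshape R1 "single-current second moment" —
# glue stub `stub_singlePairTree`: the ADC2021 Prop. A.3 tree bound for the SINGLE sourced-current cluster

Route `FKParityRobustness`, sub-problem `Ising3DConformalLimit`; `--supports` file of the registered glue stub
`stub_singlePairTree` of the reshape skeleton R1 (`IndependentStrandsJoinR1.lean`, lead c1-0).  The skeleton's
vocabulary (`tau`, `sTwo`, `treeTau`) is not in the tree, so the statement is written INLINED over tree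
vocabulary (definitionally the skeleton's `SinglePairTree`):

  for every finite graph `G`, `β ≥ 0`, `x ≠ y` and all `u, v`,
  `⟨σ_xσ_y⟩ · P^{{x}∆{y}}_{G,β}[u ∈ 𝐂_n(x) ∧ v ∈ 𝐂_n(x)]
      ≤ ⟨σ_xσ_u⟩⟨σ_uσ_v⟩⟨σ_vσ_y⟩ + ⟨σ_xσ_v⟩⟨σ_vσ_u⟩⟨σ_uσ_y⟩`     (free b.c., zero field),

i.e. the two-point function of the cluster of `x` in a SINGLE random current with sources `{x, y}`
(`currentLaw G β ({x} ∆ {y})`, `SourcedCurrentLaw.lean`) obeys the Aizenman–Duminil-Copin tree bound.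

Proof (Aizenman–Duminil-Copin 2021, Appendix A.2, Prop. A.3, with one extra sourceless current thrown in).
Write `Z[A] = Σ_{∂n = A} w_β(n)` (`currentSum`, in `ℝ≥0∞`: `ecurrentSum (fun _ => β)`).
(1) `P^A[S] = (Σ_{∂n = A} w(n) 1[n ∈ S]) / Z[A]` (`currentLaw_real_apply`), and `⟨σ_aσ_b⟩ = Z[{a}∆{b}]/Z[∅]`
(`isingTwoPoint_free_eq_currentSum_div_holds`), so the left side is `N/Z[∅]` with
`N = Σ_{∂n={x}∆{y}} w(n) 1[u, v ∈ 𝐂_n(x)]` (and `0 ≤ N/Z[∅]` in the junk case `Z[{x}∆{y}] = 0`).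
(2) `N · Z[∅] = Σ_{∂n₁={x}∆{y}, ∂n₂=∅} w w 1[u, v ∈ 𝐂_{n₁}(x)]
      ≤ Σ_{∂n₁={x}∆{y}, ∂n₂=∅} w w 1[u ∈ 𝐂_{n₁+n₂}(x)] 1[v ∈ 𝐂_{n₁+n₂}(x)]`
(Fubini in `ℝ≥0∞`, `tsum_mul_tsum_eq_tsum_prod`; cluster monotonicity `Current.cluster_mono`, `n₁ ≤ n₁ + n₂`).
(3) Prop. A.3 as proved in the tree (`Current.ecurrentSum_empty_mul_tsum_double_conn_le`, `o := x`, `x := y`):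
`Z[∅] · (that pair sum) ≤ Z[xv]Z[vu]Z[uy] + Z[xu]Z[uv]Z[vy]`.  (4) Cast to `ℝ` (`toReal_ecurrentSum`) and divide
by `Z[∅]³ > 0` (`currentSum_empty_pos'`).  The hypothesis `x ≠ y` is not used (for `x = y` both the skeleton's
statement and this proof remain valid, `{x} ∆ {x} = ∅`, `⟨σ_xσ_x⟩ = 1`); it is kept because the registered
signature carries it.

Theorem-only file (no new definitions); helper namespace `…Theorems.SinglePairTree` (prefix `spt_`).
References: M. Aizenman, H. Duminil-Copin, Ann. of Math. 194 (2021), arXiv:1912.07973, Appendix A.2, Prop. A.3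
[AizenmanDuminilCopinAnnals2021]; H. Duminil-Copin, arXiv:1607.06933, Def. 3.2 (the law `P^A`) [DuminilCopin2016].
-/

noncomputable section

open Finset SimpleGraph MeasureTheory
open Literature.Probability.LatticeModels
open scoped ENNReal symmDiff

namespace Summit.CriticalPhenomena.Ising3DConformalLimit.Theorems

namespace SinglePairTree

variable {V : Type*} [Fintype V] [DecidableEq V] (G : SimpleGraph V) [DecidableRel G.Adj]

open Classical in
/-- The probability of a set `S` of currents under the single sourced current `P^A_{G,β}` (`β ≥ 0`) as a
quotient of current sums: `P^A[S] = (Σ_n 1[n ∈ S] 1[∂n = A] w_β(n)) / Z[A]` (Duminil-Copin 2016, Def. 3.2;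
`currentLaw_real_apply` with the normalisation pulled out). -/
theorem spt_currentLaw_real_eq_tsum_div {β : ℝ} (hβ : 0 ≤ β) (A : Finset V) (S : Set (Current G)) :
    (currentLaw G β A).real S =
      (∑' n : Current G, if n ∈ S then (if n.sources = A then n.weight β else 0) else 0) / currentSum G β A := by
  rw [currentLaw_real_apply G hβ A S, ← tsum_div_const]
  refine tsum_congr fun n => ?_
  by_cases hn : n ∈ S
  · rw [if_pos hn, if_pos hn, currentProb]
  · rw [if_neg hn, if_neg hn, zero_div]

open Classical in
/-- **The `ℝ≥0∞` core** (ADC2021 Prop. A.3 plus one sourceless current): for `β ≥ 0` and all `x, y, u, v`,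
`Z[∅]² · Σ_{∂n = {x}∆{y}} w_β(n) 1[u, v ∈ 𝐂_n(x)] ≤ Z[xv]Z[vu]Z[uy] + Z[xu]Z[uv]Z[vy]`, all current sums with the
constant coupling `β` (`ecurrentSum (fun _ => β)`).  Step (2)+(3) of the module docstring. -/
theorem spt_core {β : ℝ} (hβ : 0 ≤ β) (x y u v : V) :
    ecurrentSum (fun _ : G.edgeFinset => β) ∅ * ecurrentSum (fun _ : G.edgeFinset => β) ∅ *
        (∑' n : Current G, if u ∈ n.cluster x ∧ v ∈ n.cluster x then
          (if n.sources = {x} ∆ {y} then n.eweight (fun _ : G.edgeFinset => β) else 0) else 0) ≤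
      ecurrentSum (fun _ : G.edgeFinset => β) ({x} ∆ {v}) * ecurrentSum (fun _ : G.edgeFinset => β) ({v} ∆ {u}) *
          ecurrentSum (fun _ : G.edgeFinset => β) ({u} ∆ {y}) +
        ecurrentSum (fun _ : G.edgeFinset => β) ({x} ∆ {u}) * ecurrentSum (fun _ : G.edgeFinset => β) ({u} ∆ {v}) *
          ecurrentSum (fun _ : G.edgeFinset => β) ({v} ∆ {y}) := by
  set K : G.edgeFinset → ℝ := fun _ => β
  have hK : ∀ e, 0 ≤ K e := fun _ => hβ
  -- (2a) Fubini: throw in an independent sourceless current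
  have hfub : (∑' n : Current G, if u ∈ n.cluster x ∧ v ∈ n.cluster x then
        (if n.sources = {x} ∆ {y} then n.eweight K else 0) else 0) * ecurrentSum K ∅ =
      ∑' p : Current G × Current G, epairWeight K ({x} ∆ {y}) ∅ p *
        (if u ∈ p.1.cluster x ∧ v ∈ p.1.cluster x then 1 else 0) := by
    unfold ecurrentSum
    rw [tsum_mul_tsum_eq_tsum_prod]
    refine tsum_congr fun p => ?_
    rw [epairWeight_eq_mul]
    by_cases h : u ∈ p.1.cluster x ∧ v ∈ p.1.cluster x
    · rw [if_pos h, if_pos h, mul_one]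
    · rw [if_neg h, if_neg h, zero_mul, mul_zero]
  -- (2b) cluster monotonicity `𝐂_{n₁}(x) ⊆ 𝐂_{n₁+n₂}(x)`, termwise
  have hmono : (∑' p : Current G × Current G, epairWeight K ({x} ∆ {y}) ∅ p *
        (if u ∈ p.1.cluster x ∧ v ∈ p.1.cluster x then (1 : ℝ≥0∞) else 0)) ≤
      ∑' p : Current G × Current G, epairWeight K ({x} ∆ {y}) ∅ p *
        ((if u ∈ (p.1 + p.2).cluster x then 1 else 0) * (if v ∈ (p.1 + p.2).cluster x then 1 else 0)) := by
    refine ENNReal.tsum_le_tsum fun p => mul_le_mul' le_rfl ?_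
    by_cases h : u ∈ p.1.cluster x ∧ v ∈ p.1.cluster x
    · have hu : u ∈ (p.1 + p.2).cluster x := Current.cluster_mono (self_le_add_right p.1 p.2) x h.1
      have hv : v ∈ (p.1 + p.2).cluster x := Current.cluster_mono (self_le_add_right p.1 p.2) x h.2
      rw [if_pos h, if_pos hu, if_pos hv, mul_one]
    · rw [if_neg h]
      exact bot_le
  -- (3) Prop. A.3 for the double current `P^{xy} ⊗ P^∅`
  have hA3 := Current.ecurrentSum_empty_mul_tsum_double_conn_le (K := K) hK x y u v
  calc ecurrentSum K ∅ * ecurrentSum K ∅ *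
        (∑' n : Current G, if u ∈ n.cluster x ∧ v ∈ n.cluster x then
          (if n.sources = {x} ∆ {y} then n.eweight K else 0) else 0)
      = ecurrentSum K ∅ * ((∑' n : Current G, if u ∈ n.cluster x ∧ v ∈ n.cluster x then
          (if n.sources = {x} ∆ {y} then n.eweight K else 0) else 0) * ecurrentSum K ∅) := by ring
    _ = ecurrentSum K ∅ * ∑' p : Current G × Current G, epairWeight K ({x} ∆ {y}) ∅ p *
          (if u ∈ p.1.cluster x ∧ v ∈ p.1.cluster x then 1 else 0) := by rw [hfub]
    _ ≤ ecurrentSum K ∅ * ∑' p : Current G × Current G, epairWeight K ({x} ∆ {y}) ∅ p *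
          ((if u ∈ (p.1 + p.2).cluster x then 1 else 0) * (if v ∈ (p.1 + p.2).cluster x then 1 else 0)) :=
        mul_le_mul' le_rfl hmono
    _ ≤ _ := hA3

/-- Elementary real arithmetic behind the division by `Z[∅]³`: if `0 < z`, `0 ≤ N` and `z·z·N ≤ T` then
`(a/z)·(N/a) ≤ T/z³` (for `a = 0` the left side is `0`; otherwise it is `N/z`). -/
theorem spt_div_le {z a N T : ℝ} (hz : 0 < z) (hN : 0 ≤ N) (h : z * z * N ≤ T) :
    a / z * (N / a) ≤ T / (z * z * z) := by
  have hL : a / z * (N / a) ≤ N / z := by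
    rcases eq_or_ne a 0 with rfl | ha
    · rw [zero_div, zero_mul]
      exact div_nonneg hN hz.le
    · rw [div_mul_div_comm, mul_comm a N, mul_div_mul_right _ _ ha]
  calc a / z * (N / a) ≤ N / z := hL
    _ = z * z * N / (z * z * z) := (mul_div_mul_left N z (mul_ne_zero hz.ne' hz.ne')).symm
    _ ≤ T / (z * z * z) := div_le_div_of_nonneg_right h (le_of_lt (by positivity))

open Classical in
/-- **The real form of the core**: `Z[∅]² · N ≤ Z[xv]Z[vu]Z[uy] + Z[xu]Z[uv]Z[vy]` with the tree's real current
sums `currentSum G β` and `N = Σ_{∂n = {x}∆{y}} w_β(n) 1[u, v ∈ 𝐂_n(x)]` (step (4): `toReal_ecurrentSum`). -/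
theorem spt_core_real {β : ℝ} (hβ : 0 ≤ β) (x y u v : V) :
    currentSum G β ∅ * currentSum G β ∅ *
        (∑' n : Current G, if u ∈ n.cluster x ∧ v ∈ n.cluster x then
          (if n.sources = {x} ∆ {y} then n.weight β else 0) else 0) ≤
      currentSum G β ({x} ∆ {v}) * currentSum G β ({v} ∆ {u}) * currentSum G β ({u} ∆ {y}) +
        currentSum G β ({x} ∆ {u}) * currentSum G β ({u} ∆ {v}) * currentSum G β ({v} ∆ {y}) := by
  have hK : ∀ e : G.edgeFinset, 0 ≤ (fun _ : G.edgeFinset => β) e := fun _ => hβ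
  have hZ : ∀ A : Finset V, (ecurrentSum (fun _ : G.edgeFinset => β) A).toReal = currentSum G β A :=
    fun A => by rw [toReal_ecurrentSum hK A, currentSum_eq_wcurrentSum]
  have hfin : ∀ A : Finset V, ecurrentSum (fun _ : G.edgeFinset => β) A ≠ ∞ :=
    fun A => ecurrentSum_ne_top hK A
  -- the single sum, cast to `ℝ`
  have hne : ∀ n : Current G, (if u ∈ n.cluster x ∧ v ∈ n.cluster x then
      (if n.sources = {x} ∆ {y} then n.eweight (fun _ : G.edgeFinset => β) else 0) else 0) ≠ ∞ := fun n => by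
    split_ifs
    · exact Current.eweight_ne_top _ n
    · exact ENNReal.zero_ne_top
    · exact ENNReal.zero_ne_top
  have hN : (∑' n : Current G, if u ∈ n.cluster x ∧ v ∈ n.cluster x then
        (if n.sources = {x} ∆ {y} then n.eweight (fun _ : G.edgeFinset => β) else 0) else 0).toReal =
      ∑' n : Current G, if u ∈ n.cluster x ∧ v ∈ n.cluster x then
        (if n.sources = {x} ∆ {y} then n.weight β else 0) else 0 := by
    rw [ENNReal.tsum_toReal_eq hne]
    refine tsum_congr fun n => ?_
    split_ifs
    · rw [Current.toReal_eweight hK, Current.weight_eq_wweight]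
    · simp
    · simp
  have hcore := spt_core G hβ x y u v
  have hRfin : ecurrentSum (fun _ : G.edgeFinset => β) ({x} ∆ {v}) *
          ecurrentSum (fun _ : G.edgeFinset => β) ({v} ∆ {u}) * ecurrentSum (fun _ : G.edgeFinset => β) ({u} ∆ {y}) +
        ecurrentSum (fun _ : G.edgeFinset => β) ({x} ∆ {u}) *
          ecurrentSum (fun _ : G.edgeFinset => β) ({u} ∆ {v}) * ecurrentSum (fun _ : G.edgeFinset => β) ({v} ∆ {y}) ≠
      ∞ :=
    ENNReal.add_ne_top.2 ⟨ENNReal.mul_ne_top (ENNReal.mul_ne_top (hfin _) (hfin _)) (hfin _),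
      ENNReal.mul_ne_top (ENNReal.mul_ne_top (hfin _) (hfin _)) (hfin _)⟩
  have hreal := ENNReal.toReal_mono hRfin hcore
  rw [ENNReal.toReal_add (ENNReal.mul_ne_top (ENNReal.mul_ne_top (hfin _) (hfin _)) (hfin _))
    (ENNReal.mul_ne_top (ENNReal.mul_ne_top (hfin _) (hfin _)) (hfin _))] at hreal
  simpa only [ENNReal.toReal_mul, hZ, hN] using hreal

/-- **The tree bound for the single sourced-current cluster** (finite graph, `β ≥ 0`, all `x, y, u, v`):
`⟨σ_xσ_y⟩ · P^{{x}∆{y}}[u, v ∈ 𝐂_n(x)] ≤ ⟨σ_xσ_u⟩⟨σ_uσ_v⟩⟨σ_vσ_y⟩ + ⟨σ_xσ_v⟩⟨σ_vσ_u⟩⟨σ_uσ_y⟩` (free b.c.),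
from `spt_core_real`, `P^A[S] = N/Z[A]` (`spt_currentLaw_real_eq_tsum_div`) and `⟨σ_aσ_b⟩ = Z[{a}∆{b}]/Z[∅]`
(`isingTwoPoint_free_eq_currentSum_div_holds`); in the junk case `Z[{x}∆{y}] = 0` the left side is `0`. -/
theorem spt_singlePairTree {β : ℝ} (hβ : 0 ≤ β) (x y u v : V) :
    isingTwoPoint G Finset.univ β 0 .free x y *
        (currentLaw G β ({x} ∆ {y})).real {n | u ∈ n.cluster x ∧ v ∈ n.cluster x} ≤
      isingTwoPoint G Finset.univ β 0 .free x u * isingTwoPoint G Finset.univ β 0 .free u v *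
          isingTwoPoint G Finset.univ β 0 .free v y +
        isingTwoPoint G Finset.univ β 0 .free x v * isingTwoPoint G Finset.univ β 0 .free v u *
          isingTwoPoint G Finset.univ β 0 .free u y := by
  have hτ : ∀ a b : V, isingTwoPoint G Finset.univ β 0 .free a b =
      currentSum G β ({a} ∆ {b}) / currentSum G β ∅ :=
    fun a b => isingTwoPoint_free_eq_currentSum_div_holds G β a b
  have hZ0 : 0 < currentSum G β ∅ := currentSum_empty_pos' G β
  have hcore := spt_core_real G hβ x y u v
  -- (1) `P^{xy}[S] = N / Z[xy]` (the helper's classical `if` against the statement's decidable one)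
  have hS : (currentLaw G β ({x} ∆ {y})).real {n | u ∈ n.cluster x ∧ v ∈ n.cluster x} =
      (∑' n : Current G, if u ∈ n.cluster x ∧ v ∈ n.cluster x then
        (if n.sources = {x} ∆ {y} then n.weight β else 0) else 0) / currentSum G β ({x} ∆ {y}) := by
    rw [spt_currentLaw_real_eq_tsum_div G hβ]
    congr 1
    refine tsum_congr fun n => ?_
    by_cases hn : u ∈ n.cluster x ∧ v ∈ n.cluster x
    · rw [if_pos (show n ∈ {n : Current G | u ∈ n.cluster x ∧ v ∈ n.cluster x} from hn), if_pos hn]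
    · rw [if_neg (show n ∉ {n : Current G | u ∈ n.cluster x ∧ v ∈ n.cluster x} from hn), if_neg hn]
  have hNnn : 0 ≤ ∑' n : Current G, if u ∈ n.cluster x ∧ v ∈ n.cluster x then
      (if n.sources = {x} ∆ {y} then n.weight β else 0) else 0 :=
    tsum_nonneg fun n => by
      split_ifs
      · exact Current.weight_nonneg hβ n
      · exact le_rfl
      · exact le_rfl
  -- (2)–(4) the core divided by `Z[∅]³`, then back to two-point functions
  rw [hS, hτ x y]
  refine (spt_div_le hZ0 hNnn (hcore.trans_eq (add_comm _ _))).trans_eq ?_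
  simp only [hτ]
  rw [div_mul_div_comm, div_mul_div_comm, div_mul_div_comm, div_mul_div_comm, ← add_div]

end SinglePairTree

/-! ### The stub, top level (registered signature, inlined vocabulary) -/

/-- **Glue stub `stub_singlePairTree` of the reshape R1 of crux `IndependentStrandsJoin`** (ADC2021 Prop. A.3 for the
SINGLE sourced current, every finite graph): for `β ≥ 0`, `x ≠ y` and all `u, v`,
`τ(xy) · P^{{x}∆{y}}_{G,β}[u ∈ 𝐂_n(x) ∧ v ∈ 𝐂_n(x)] ≤ τ(xu)τ(uv)τ(vy) + τ(xv)τ(vu)τ(uy)`,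
`τ = isingTwoPoint G univ β 0 .free` (so `τ(a,a) = 1`).  Definitionally the skeleton's `SinglePairTree`
(`tau`, `sTwo`, `treeTau` inlined); this is `SinglePairTree.spt_singlePairTree` (which does not need `x ≠ y`). -/
theorem stub_singlePairTree :
    ∀ (V : Type) [Fintype V] [DecidableEq V] (G : SimpleGraph V) [DecidableRel G.Adj] (β : ℝ), 0 ≤ β →
      ∀ x y u v : V, x ≠ y →
        isingTwoPoint G Finset.univ β 0 .free x y *
            (currentLaw G β ({x} ∆ {y})).real {n | u ∈ n.cluster x ∧ v ∈ n.cluster x}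
          ≤ isingTwoPoint G Finset.univ β 0 .free x u * isingTwoPoint G Finset.univ β 0 .free u v *
              isingTwoPoint G Finset.univ β 0 .free v y
            + isingTwoPoint G Finset.univ β 0 .free x v * isingTwoPoint G Finset.univ β 0 .free v u *
              isingTwoPoint G Finset.univ β 0 .free u y :=
  fun _ _ _ G _ _ hβ x y u v _ => SinglePairTree.spt_singlePairTree G hβ x y u v

end Summit.CriticalPhenomena.Ising3DConformalLimit.Theorems

end
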